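import Mathlib
import Summits.ResolutionOfSingularities.ResolutionOfSingularities.Theorems.WeightedInvariantLocalWeightedDropWildMonicFlagDropAxisN0Package
import Summits.ResolutionOfSingularities.ResolutionOfSingularities.Theorems.WeightedInvariantLocalWeightedDropWildMonicFlagDropTangentFirst
import Summits.ResolutionOfSingularities.ResolutionOfSingularities.Theorems.WeightedInvariantLocalWeightedDropWildMonicFlagDropAxisN1Second
import Summits.ResolutionOfSingularities.ResolutionOfSingularities.Theorems.WeightedInvariantLocalWeightedDropWildMonicFlagDropKangarooPackage
import Summits.ResolutionOfSingularities.ResolutionOfSingularities.Theorems.WeightedInvariantLocalWeightedDropWildMonicFlagDropKangarooCaseTwo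
import Summits.ResolutionOfSingularities.ResolutionOfSingularities.Theorems.WeightedInvariantLocalWeightedDropWildMonicFlagDropKangarooTangentHolds

/-!
# `WeightedInvariant.LocalWeightedDrop`, line `hasse-ridge-face-selection`, S3ρ: THE DROP SHAPE OF THE FLAG FAMILY BY NAME —
# `DropShape (IsFlagTriple d) p` from `AttainShape (IsFlagTriple d) p` alone (Per17 Prop. 9.1.4 in game form, all child-flag types)

Crux item stmt-ResolutionOfSingularities-8899 `LocalWeightedDrop` (route `ResolutionOfSingularities/WeightedInvariant`), engine of the door
`HypersurfaceCentreConstruction` stmt-ResolutionOfSingularities-19897.  [OURS · L1 W4.3, chain w43, res-D-pv-005 AS res-L1-w43-stub-7: the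
COMPOSITION of the flag line's landed drop pieces («flag line = tools, finish in-flight», res-L1-w43-plan-1 RULING gen 9 #7) — no new
statement; every case theorem is cited by name below.  MAP: S. Perlega, arXiv:2011.14443 Prop. 9.1.4 (p0103–p0106), cases (1)–(4);
every object OURS; not a statement of H. Hironaka's manuscript [claim: Hironaka2017, status: under-review].]

* `pos_of_not_exit₃` — off `Exit₃` the degree is positive (the empty tuple is the zero exit);
* `dropAxisShape` — `DropAxisShape d p k` (`…FlagDropSplit`) from its five child-flag types (`dropAxisShape_of_cases`, res-type-083):
  `dropAxisN0First` / `dropAxisN0Second` (`…FlagDropAxisN0Package`, on `axisPackageN0_holds`), `dropAxisTangentFirst` (res-D-pv-056 AS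
  res-L1-w43-stub-5), `dropAxisN1Second_holds` (res-D-repro-2), `dropAxisKangaroo_holds` (res-type-056);
* `dropKangarooShape` — `DropKangarooShape d p k` from its three types (`dropKangarooShape_of_cases`, res-type-083): `dropKangarooFirst` /
  `dropKangarooNewAxis` (res-L1-w43-stub-2), `dropKangarooTangent_holds` (res-type-056);
* `dropShape_isFlagTriple_of_attainShape` — **`AttainShape (IsFlagTriple d) p → DropShape (IsFlagTriple d) p`** over a perfect field of
  characteristic `p` (res-type-083's `dropShape_isFlagTriple_of_split`): of the three shapes of `wildMonicSurfaceReductionWon_of_shapes`, the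
  flag line's DROP is thereby reduced to its ATTAIN (D-0).
-/

set_option linter.dupNamespace false -- mandated namespace of this single-conjunct summit

noncomputable section

namespace Summit.ResolutionOfSingularities.ResolutionOfSingularities.Theorems

namespace WildMonic

open MvPowerSeries MonicDescent Literature.AlgebraicGeometry.Resolution
open PurePowerFlag (succE IsN0)

variable {k : Type} [Field k] {d : ℕ}

/-- OFF `Exit₃` THE DEGREE IS POSITIVE: for `d = 0` the (empty) tuple is the zero exit. -/
theorem pos_of_not_exit₃ {p : ℕ} {A : Fin d → MvPowerSeries (Fin 2) k} (hA : IsPos d A) (hex : ¬ Exit₃ p d A) : 0 < d := by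
  rcases Nat.eq_zero_or_pos d with h0 | h
  · subst h0; exact absurd (exit₃_of_eq_zero hA fun j => j.elim0) hex
  · exact h

variable (p : ℕ) [Fact p.Prime] [CharP k p] [PerfectRing k p]

/-- **THE AXIS DROP OF THE FLAG FAMILY** [Per17 Prop. 9.1.4 at `t = 0`, all child-flag types]: `DropAxisShape d p k`. -/
theorem dropAxisShape : DropAxisShape d p k := by
  intro A E T φ' hA hex
  have hd : 0 < d := pos_of_not_exit₃ hA hex
  exact dropAxisShape_of_cases (dropAxisN0First p) (dropAxisTangentFirst p hd) (dropAxisN0Second p) (dropAxisN1Second_holds p hd)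
    (dropAxisKangaroo_holds p) A E T φ' hA hex

/-- **THE TRANSLATED DROP WITH TWO LOST COMPONENTS** [Per17 Prop. 9.1.4 cases (2) and (4) at `t ≠ 0`]: `DropKangarooShape d p k`. -/
theorem dropKangarooShape : DropKangarooShape d p k := by
  intro A E t T φ' vmax hA hex
  have hd : 0 < d := pos_of_not_exit₃ hA hex
  exact dropKangarooShape_of_cases (dropKangarooFirst p hd) (dropKangarooNewAxis p hd) (dropKangarooTangent_holds p) A E t T φ' vmax hA hex

/-- **THE DROP SHAPE OF THE FLAG FAMILY FROM ITS ATTAIN SHAPE** [Per17 Prop. 9.1.4 in game form]: over a perfect field of characteristic `p`,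
`AttainShape (IsFlagTriple d) p → DropShape (IsFlagTriple d) p`. -/
theorem dropShape_isFlagTriple_of_attainShape (hattain : AttainShape (IsFlagTriple d (k := k)) p) : DropShape (IsFlagTriple d (k := k)) p :=
  dropShape_isFlagTriple_of_split hattain (dropAxisShape p) (dropKangarooShape p)

end WildMonic

end Summit.ResolutionOfSingularities.ResolutionOfSingularities.Theorems

end
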